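import Mathlib
import Literature.NumberTheory.Transcendental.SiegelWrapper
import Literature.NumberTheory.Transcendental.SixExponentialsPadicProofs

/-!
# Crux `HilbertIntegralOverconvergentIsCongruence` (stmt-Langlands-8485), line `Sketch-ideate-r1-k1`:
# the `d`-free transcendence endgame (auxiliary linear forms: Siegel + Liouville + geometric gain)

The Arakelov-free assembly of idea `sturm-slope-engine` (Schneider–Lang template) ends, in every
dimension `d = [F:ℚ]`, with the same piece of pure arithmetic: for each "degree" `D` one has `q_D`
unknown algebraic-integer coefficients `P_u` (`q_D ≤ Q^D`), linear forms
`S_P(ν) = Σ_u P_u · c_D(u, ν)` indexed by exponents `ν` of weight `ℓ(ν) ∈ ℕ` (the coefficients of the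
auxiliary function `F_P = Σ_u P_u b_u` at the cusp), with `c_D(u, ν) ∈ 𝓞_E` of archimedean size
`≤ B^D e^{η ℓ(ν)}` under every complex embedding (Cauchy on a polydisc of radius `e^{-η}`), fewer than
`q_D / 2` exponents of weight `< N₀(D)` where `N₀(D)/D → ∞` (lattice-point count `≍ N₀^d` against
`q_D ≍ D^{d+1}`), and the GAIN delivered by the `d`-free Katz–Sturm lever
(`stub_katzSturmAbstract`): if `S_P` vanishes in all weights `< n` then `‖v(S_P(ν))‖ ≤ A^D R^{-n}` at a
`p`-adic place `v`, with `R > e^{2η[E:ℚ]}`.  CONCLUSION: some `P ≠ 0` has `S_P ≡ 0` (i.e. `F_P = 0`, an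
algebraic relation for `g`).  Proof: Siegel's lemma over `𝓞_E` (`siegel_house`) makes `S_P` vanish in
weights `< N₀(D)` with `house(P) ≤ C_E² q_D B^D e^{η N₀(D)}`; if `S_P ≢ 0`, its lowest non-zero value
`α = S_P(ν₀)`, `ℓ(ν₀) = n ≥ N₀(D)`, is a non-zero algebraic integer with conjugates
`≤ C_E² q_D² B^{2D} e^{2ηn}` and `‖v(α)‖ ≤ A^D R^{-n}`, so the Liouville inequality
(`SixExpPadic.liouville_padic`) gives `1 ≤ Θ^D (e^{2η[E:ℚ]}/R)^{n} ≤ (Θ s^m)^D` with `s < 1`, `mD ≤ N₀(D)`,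
false for `m`, then `D`, large.  No power series, no dimension: those enter only through the
hypotheses, which the one-variable line (`CapacityClassicality.stub_auxPoly`) and the Hilbert engine
instantiate.  Theorems only, no `sorry`.
-/

set_option linter.dupNamespace false

noncomputable section

open NumberField

namespace Summit.Langlands.Langlands.Theorems.HilbertIntegralOverconvergentIsCongruence

/-- **The `d`-free transcendence endgame (registered stub `stub_auxLinearForms`).**  `E` a number
field with a `p`-adic embedding `v`, exponents `X` weighted by `ℓ : X → ℕ`; for each `D : ℕ` a finite
type of unknowns `β D` and coefficients `c D u ν ∈ E`, algebraic integers with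
`‖σ(c D u ν)‖ ≤ B^D e^{η ℓ ν}` for every `σ : E →+* ℂ`; thresholds `N₀ D` with finitely many, and fewer
than `card (β D) / 2`, exponents of weight `< N₀ D`, `N₀ D ≥ m D` for every `m` at some `D ≥ 1`, and
`card (β D) ≤ Q^D`; GAIN: whenever the linear forms `ν ↦ Σ_u P_u c D u ν` (`P_u ∈ 𝓞_E`) vanish in all
weights `< n`, all their values have `v`-adic norm `≤ A^D R^{-n}`, where `e^{2η[E:ℚ]} < R`.  Then for
some `D` there is `P ≠ 0` with `Σ_u P_u c D u ν = 0` for every `ν`. [folklore] -/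
theorem stub_auxLinearForms (E : Type) [Field E] [NumberField E] (p : ℕ) [Fact p.Prime]
    (v : E →+* PadicAlgCl p) (X : Type) (ℓ : X → ℕ) (β : ℕ → Type) [∀ D, Fintype (β D)]
    (N₀ : ℕ → ℕ) (hfin : ∀ D, {ν : X | ℓ ν < N₀ D}.Finite)
    (hcount : ∀ D, 1 ≤ D → 2 * {ν : X | ℓ ν < N₀ D}.ncard < Fintype.card (β D))
    (hgrowth : ∀ m : ℕ, ∃ D : ℕ, 1 ≤ D ∧ m * D ≤ N₀ D)
    (Q : ℝ) (hQ : ∀ D, 1 ≤ D → (Fintype.card (β D) : ℝ) ≤ Q ^ D)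
    (c : (D : ℕ) → β D → X → E) (hint : ∀ D u ν, IsIntegral ℤ (c D u ν))
    (B η : ℝ) (hB : 1 ≤ B) (hη : 0 ≤ η)
    (harch : ∀ (D : ℕ) (u : β D) (ν : X) (σ : E →+* ℂ), ‖σ (c D u ν)‖ ≤ B ^ D * Real.exp (η * ℓ ν))
    (A R : ℝ) (hA : 1 ≤ A) (hR : Real.exp (2 * η * Module.finrank ℚ E) < R)
    (hgain : ∀ (D : ℕ) (P : β D → 𝓞 E) (n : ℕ),
      (∀ ν, ℓ ν < n → ∑ u, (P u : E) * c D u ν = 0) →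
      ∀ ν, ‖v (∑ u, (P u : E) * c D u ν)‖ ≤ A ^ D * R⁻¹ ^ n) :
    ∃ (D : ℕ) (P : β D → 𝓞 E), P ≠ 0 ∧ ∀ ν, ∑ u, (P u : E) * c D u ν = 0 := by
  classical
  by_contra H
  push Not at H
  /- ### constants independent of `D` -/
  set dE : ℕ := Module.finrank ℚ E with hdE_def
  have hdE : 1 ≤ dE := Module.finrank_pos
  set CE : ℝ := Literature.NumberTheory.Transcendental.siegelConst E with hCE_def
  have hCE1 : 1 ≤ CE := Literature.NumberTheory.Transcendental.one_le_siegelConst E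
  have hexp1 : 1 ≤ Real.exp (2 * η * dE) := Real.one_le_exp (by positivity)
  have hR1 : 1 < R := lt_of_le_of_lt hexp1 hR
  have hR0 : 0 < R := zero_lt_one.trans hR1
  -- `Q ≥ 1`: at `D = 1` there is at least one unknown
  have hQ1 : 1 ≤ Q := by
    have h1 : (1 : ℝ) ≤ Fintype.card (β 1) := by
      have := hcount 1 le_rfl
      exact_mod_cast (show 1 ≤ Fintype.card (β 1) by omega)
    simpa using h1.trans (hQ 1 le_rfl)
  -- the ratio `s < 1` and the per-degree factor `Θ`
  set e1 : ℝ := Real.exp (2 * η) with he1_def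
  have he1_1 : 1 ≤ e1 := Real.one_le_exp (by positivity)
  have he1dE : e1 ^ dE = Real.exp (2 * η * dE) := by
    rw [he1_def, ← Real.exp_nat_mul]; ring_nf
  set s : ℝ := e1 ^ dE * R⁻¹ with hs_def
  have hs0 : 0 < s := by positivity
  have hs1 : s < 1 := by
    rw [hs_def, he1dE, ← div_eq_mul_inv, div_lt_one hR0]
    exact hR
  set Y : ℝ := CE ^ 2 * Q ^ 2 * B ^ 2 with hY_def
  have hY1 : 1 ≤ Y := one_le_mul_of_one_le_of_one_le
    (one_le_mul_of_one_le_of_one_le (one_le_pow₀ hCE1) (one_le_pow₀ hQ1)) (one_le_pow₀ hB)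
  set Θ : ℝ := A * Y ^ dE with hΘ_def
  have hΘ1 : 1 ≤ Θ := one_le_mul_of_one_le_of_one_le hA (one_le_pow₀ hY1)
  have hΘ0 : 0 < Θ := zero_lt_one.trans_le hΘ1
  -- choose `m` with `Θ s^m < 1`, then `D ≥ 1` with `m D ≤ N₀ D`
  obtain ⟨m, hm⟩ := exists_pow_lt_of_lt_one (inv_pos.mpr hΘ0) hs1
  have hΘsm : Θ * s ^ m < 1 := by
    have := mul_lt_mul_of_pos_left hm hΘ0
    rwa [mul_inv_cancel₀ hΘ0.ne'] at this
  obtain ⟨D, hD1, hmD⟩ := hgrowth m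
  /- ### Siegel's lemma at degree `D` -/
  set q : ℕ := Fintype.card (β D) with hq_def
  have hSfin := hfin D
  set T : Finset X := hSfin.toFinset with hT_def
  have hTmem : ∀ ν, ν ∈ T ↔ ℓ ν < N₀ D := fun ν ↦ by
    rw [hT_def, Set.Finite.mem_toFinset]; rfl
  have hTcard : T.card = {ν : X | ℓ ν < N₀ D}.ncard := by
    rw [hT_def, Set.ncard_eq_toFinset_card _ hSfin]
  have hcountD : 2 * T.card < q := by rw [hTcard]; exact hcount D hD1
  have hqpos : 0 < q := by omega
  haveI : Nonempty (β D) := Fintype.card_pos_iff.mp hqpos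
  have hq1 : (1 : ℝ) ≤ q := by exact_mod_cast hqpos
  have hqQ : (q : ℝ) ≤ Q ^ D := hQ D hD1
  set Ab : ℝ := B ^ D * Real.exp (η * N₀ D) with hAb_def
  have hAb1 : 1 ≤ Ab :=
    one_le_mul_of_one_le_of_one_le (one_le_pow₀ hB) (Real.one_le_exp (by positivity))
  set Hs : ℝ := CE * (CE * q * Ab) with hHs_def
  have hbase : 1 ≤ CE * q * Ab :=
    one_le_mul_of_one_le_of_one_le (one_le_mul_of_one_le_of_one_le hCE1 hq1) hAb1
  have hHs1 : 1 ≤ Hs := one_le_mul_of_one_le_of_one_le hCE1 hbase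
  obtain ⟨P, hP0, hvanP, hhouseP⟩ : ∃ P : β D → 𝓞 E, P ≠ 0 ∧
      (∀ ν, ℓ ν < N₀ D → ∑ u, (P u : E) * c D u ν = 0) ∧ ∀ u, house ((P u : 𝓞 E) : E) ≤ Hs := by
    rcases Nat.eq_zero_or_pos T.card with hT0 | hT0
    · -- no condition at all: any non-zero integral vector, e.g. the constant `1`
      obtain ⟨u₀⟩ := ‹Nonempty (β D)›
      refine ⟨fun _ ↦ 1, fun h ↦ one_ne_zero (congrFun h u₀), fun ν hν ↦ ?_, fun u ↦ ?_⟩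
      · exact absurd ((hTmem ν).mpr hν) (by rw [Finset.card_eq_zero.mp hT0]; simp)
      · refine Literature.NumberTheory.Transcendental.SixExpPadic.house_le_of_forall_norm_le
          (zero_le_one.trans hHs1) fun σ ↦ ?_
        change ‖σ ((1 : 𝓞 E) : E)‖ ≤ Hs
        rw [RingOfIntegers.coe_eq_algebraMap, map_one, map_one, norm_one]
        exact hHs1
    · -- Siegel's lemma for the `T.card × q` system over `𝓞 E`
      set a : Matrix T (β D) (𝓞 E) := fun k u ↦ ⟨c D u k.1, hint D u k.1⟩ with ha_def
      have hcardα : Fintype.card T = T.card := Fintype.card_coe T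
      have hpq : T.card < q := by omega
      have habs : ∀ k u, house (algebraMap (𝓞 E) E (a k u)) ≤ Ab := by
        intro k u
        refine Literature.NumberTheory.Transcendental.SixExpPadic.house_le_of_forall_norm_le
          (zero_le_one.trans hAb1) fun σ ↦ ?_
        change ‖σ (c D u k.1)‖ ≤ Ab
        refine (harch D u k.1 σ).trans (mul_le_mul_of_nonneg_left ?_ (by positivity))
        have hk : ℓ k.1 < N₀ D := (hTmem k.1).mp k.2
        exact Real.exp_le_exp.mpr (mul_le_mul_of_nonneg_left (by exact_mod_cast hk.le) hη)
      obtain ⟨ξ, hξ0, hξmul, hξhouse⟩ := Literature.NumberTheory.Transcendental.siegel_house E a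
        hT0 hpq hcardα rfl hAb1 habs
      refine ⟨ξ, hξ0, fun ν hν ↦ ?_, fun u ↦ ?_⟩
      · have h := congrFun hξmul ⟨ν, (hTmem ν).mpr hν⟩
        rw [Pi.zero_apply, Matrix.mulVec, dotProduct] at h
        have h' := congrArg (algebraMap (𝓞 E) E) h
        rw [map_sum, map_zero] at h'
        refine Eq.trans (Finset.sum_congr rfl fun u _ ↦ ?_) h'
        rw [RingHom.map_mul (algebraMap (𝓞 E) E), mul_comm]
        rfl
      · refine (hξhouse u).trans (mul_le_mul_of_nonneg_left ?_ (zero_le_one.trans hCE1))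
        have hexp : ((T.card : ℕ) : ℝ) / (q - (T.card : ℕ)) ≤ 1 := by
          have hlt : ((T.card : ℕ) : ℝ) < q := by exact_mod_cast hpq
          rw [div_le_one (by linarith)]
          have : ((2 * T.card : ℕ) : ℝ) ≤ q := by exact_mod_cast hcountD.le
          push_cast at this
          linarith
        calc (CE * q * Ab) ^ (((T.card : ℕ) : ℝ) / (q - (T.card : ℕ))) ≤ (CE * q * Ab) ^ (1 : ℝ) :=
              Real.rpow_le_rpow_of_exponent_le hbase hexp
          _ = CE * q * Ab := Real.rpow_one _
  /- ### the lowest non-zero value `α` of the linear forms -/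
  obtain ⟨ν₁, hν₁⟩ := H D P hP0
  have hex : ∃ n, ∃ ν, ℓ ν = n ∧ ∑ u, (P u : E) * c D u ν ≠ 0 := ⟨_, ν₁, rfl, hν₁⟩
  set n₁ : ℕ := Nat.find hex with hn₁_def
  obtain ⟨ν₀, hℓν₀, hα0⟩ := Nat.find_spec hex
  have hmin : ∀ ν, ℓ ν < n₁ → ∑ u, (P u : E) * c D u ν = 0 := by
    intro ν hν
    by_contra hne
    exact Nat.find_min hex hν ⟨ν, rfl, hne⟩
  have hN₀n : N₀ D ≤ n₁ := by
    by_contra hlt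
    push Not at hlt
    exact hα0 (hvanP ν₀ (hℓν₀ ▸ hlt))
  have hmDn : m * D ≤ n₁ := hmD.trans hN₀n
  set α : E := ∑ u, (P u : E) * c D u ν₀ with hα_def
  have hαint : IsIntegral ℤ α :=
    IsIntegral.sum _ fun u _ ↦ (RingOfIntegers.isIntegral_coe (P u)).mul (hint D u ν₀)
  set αO : 𝓞 E := ⟨α, hαint⟩ with hαO_def
  have hαO0 : αO ≠ 0 := by
    intro h
    apply hα0
    have := congrArg ((↑) : 𝓞 E → E) h
    simpa [hαO_def] using this
  -- the `v`-adic gain at the vanishing weight `n₁`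
  have hgainα : ‖v α‖ ≤ A ^ D * R⁻¹ ^ n₁ := hgain D P n₁ hmin ν₀
  -- the archimedean sizes of `α`
  set Bnd : ℝ := q * (Hs * (B ^ D * Real.exp (η * n₁))) with hBnd_def
  have hBe1 : 1 ≤ B ^ D * Real.exp (η * n₁) :=
    one_le_mul_of_one_le_of_one_le (one_le_pow₀ hB) (Real.one_le_exp (by positivity))
  have hBnd1 : 1 ≤ Bnd :=
    one_le_mul_of_one_le_of_one_le hq1 (one_le_mul_of_one_le_of_one_le hHs1 hBe1)
  have hσα : ∀ σ : E →+* ℂ, ‖σ α‖ ≤ Bnd := by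
    intro σ
    rw [hα_def, map_sum]
    refine (norm_sum_le _ _).trans ?_
    have hu : ∀ u, ‖σ ((P u : E) * c D u ν₀)‖ ≤ Hs * (B ^ D * Real.exp (η * n₁)) := by
      intro u
      rw [map_mul, norm_mul]
      refine mul_le_mul ((norm_embedding_le_house _ σ).trans (hhouseP u)) ?_ (norm_nonneg _)
        (zero_le_one.trans hHs1)
      have := harch D u ν₀ σ
      rwa [hℓν₀] at this
    calc ∑ u, ‖σ ((P u : E) * c D u ν₀)‖ ≤ ∑ _u : β D, Hs * (B ^ D * Real.exp (η * n₁)) :=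
          Finset.sum_le_sum fun u _ ↦ hu u
      _ = Bnd := by
          rw [Finset.sum_const, Finset.card_univ, nsmul_eq_mul, hBnd_def]
  -- the `p`-adic Liouville inequality
  have hLiou := Literature.NumberTheory.Transcendental.SixExpPadic.liouville_padic (ℓ := p)
    (E := PadicAlgCl p) v hαO0 hBnd1 hσα
  change (Bnd ^ dE)⁻¹ ≤ ‖v α‖ at hLiou
  /- ### the contradiction -/
  have hBnd0 : 0 < Bnd := zero_lt_one.trans_le hBnd1
  have h1 : 1 ≤ Bnd ^ dE * (A ^ D * R⁻¹ ^ n₁) := by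
    have := mul_le_mul_of_nonneg_left (hLiou.trans hgainα) (pow_pos hBnd0 dE).le
    rwa [mul_inv_cancel₀ (pow_pos hBnd0 dE).ne'] at this
  -- `Bnd ≤ Y^D · e1^{n₁}`
  have hBndY : Bnd ≤ Y ^ D * e1 ^ n₁ := by
    have hHs_eq : Hs = CE ^ 2 * q * Ab := by rw [hHs_def]; ring
    have hexp2 : Real.exp (η * N₀ D) * Real.exp (η * n₁) ≤ e1 ^ n₁ := by
      rw [he1_def, ← Real.exp_nat_mul, ← Real.exp_add]
      refine Real.exp_le_exp.mpr ?_
      have : (N₀ D : ℝ) ≤ n₁ := by exact_mod_cast hN₀n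
      nlinarith
    have hCE2 : CE ^ 2 ≤ (CE ^ 2) ^ D := le_self_pow₀ (one_le_pow₀ hCE1) (by omega)
    have hq2 : (q : ℝ) ^ 2 ≤ (Q ^ 2) ^ D := by
      rw [← pow_mul, mul_comm, pow_mul]
      exact pow_le_pow_left₀ (by positivity) hqQ 2
    calc Bnd = (CE ^ 2 * (q : ℝ) ^ 2 * (B ^ D) ^ 2) * (Real.exp (η * N₀ D) * Real.exp (η * n₁)) := by
          rw [hBnd_def, hHs_eq, hAb_def]; ring
      _ ≤ ((CE ^ 2) ^ D * (Q ^ 2) ^ D * (B ^ 2) ^ D) * e1 ^ n₁ := by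
          refine mul_le_mul ?_ hexp2 (by positivity) (by positivity)
          rw [← pow_mul B D 2, mul_comm D 2, pow_mul B 2 D]
          exact mul_le_mul (mul_le_mul hCE2 hq2 (by positivity) (by positivity)) le_rfl
            (by positivity) (by positivity)
      _ = Y ^ D * e1 ^ n₁ := by rw [hY_def, mul_pow, mul_pow]
  -- hence `Bnd^dE · A^D · R^{-n₁} ≤ Θ^D s^{n₁}`
  have h2 : Bnd ^ dE * (A ^ D * R⁻¹ ^ n₁) ≤ Θ ^ D * s ^ n₁ := by
    have hB' : Bnd ^ dE ≤ (Y ^ D * e1 ^ n₁) ^ dE := pow_le_pow_left₀ hBnd0.le hBndY dE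
    calc Bnd ^ dE * (A ^ D * R⁻¹ ^ n₁) ≤ (Y ^ D * e1 ^ n₁) ^ dE * (A ^ D * R⁻¹ ^ n₁) :=
          mul_le_mul_of_nonneg_right hB' (by positivity)
      _ = Θ ^ D * s ^ n₁ := by
          rw [hΘ_def, hs_def, mul_pow, mul_pow, mul_pow, ← pow_mul, ← pow_mul, ← pow_mul, ← pow_mul,
            mul_comm D dE, mul_comm n₁ dE, pow_mul, pow_mul]
          ring
  -- and `Θ^D s^{n₁} ≤ (Θ s^m)^D < 1`
  have h3 : Θ ^ D * s ^ n₁ ≤ (Θ * s ^ m) ^ D := by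
    have hsn : s ^ n₁ ≤ s ^ (m * D) := pow_le_pow_of_le_one hs0.le hs1.le hmDn
    calc Θ ^ D * s ^ n₁ ≤ Θ ^ D * s ^ (m * D) := mul_le_mul_of_nonneg_left hsn (pow_nonneg hΘ0.le D)
      _ = (Θ * s ^ m) ^ D := by ring
  have h4 : (Θ * s ^ m) ^ D < 1 :=
    (pow_le_of_le_one (by positivity) hΘsm.le (by omega)).trans_lt hΘsm
  exact absurd (h1.trans (h2.trans h3)) (not_le.mpr h4)

end Summit.Langlands.Langlands.Theorems.HilbertIntegralOverconvergentIsCongruence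

end
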